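import Literature.MathematicalPhysics.QuantumFieldTheory.Sweep1
import Literature.MathematicalPhysics.QuantumLattice.WilsonLoops
import Literature.MathematicalPhysics.QuantumFieldTheory.AdhikariCao2022.CorrelationDecay
import Literature.LinearAlgebra.Matrix.TraceSingularValueInequality
import Mathlib.Analysis.InnerProductSpace.Trace
import HarnessLib

/-!
# Cao 2020: Wilson loop expectations to first order, lattice gauge theory with a FINITE gauge group (`ℤ⁴`, weak coupling)

Statement-level transcription (named facts `def … : Prop`, D-0014; hypothesis-free definitions of
the printed quantities) of

* S. Cao, *Wilson loop expectations in lattice gauge theories with finite gauge groups*,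
  Comm. Math. Phys. **380** (2020) 1439–1505, doi:10.1007/s00220-020-03912-z,
  arXiv:2001.05627 (v3, 24 Aug 2020). [Cao2020]

All locators are those of arXiv v3 (theorems are numbered within SUBsections there, so the main
result of §1.2 is **Theorem 1.2.1**; equations are numbered within sections; the CMP numbering was
not checked). Nothing in this file is proved about the lattice theory: the three theorems are NAMED FACTS
(users take `(h : <Name> ρ)`); the two representation-theoretic lemmas of Appendix A, typed as
named facts in v1, are PROVED in v1.2 (`ExistsFaithfulUnitaryRepOpNormLtOne_holds`,
`OpNormALimitLtOneOfIrreducible_holds`, last two sections); the other `theorem`s are definitional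
unfoldings (`rfl`) and — v1.1 — the bridges to `AdhikariCao2022` (same model, same `Δ_G`) and the
specialisation to `SimpleGraph.Walk.IsCycle`.

## The model (Cao §1.2) and how it is rendered in the tree's vocabulary

`G` a finite group, `ρ` a unitary representation of dimension `d` (here: `ρ : G →* Matrix (Fin N)
(Fin N) ℂ` with `ρ g ∈ U(N)` for all `g`, so Cao's `d` is the tree's `N` and the lattice dimension
is the literal `4`), `χ = tr ρ` its character. On a cube `Λ ⊆ ℤ⁴` the measure is
`dμ_{Λ,β}(σ) = Z⁻¹ exp(-β S_Λ(σ)) dμ_Λ(σ)`, `S_Λ(σ) = ∑_{p ∈ P(Λ)} Re (χ(1) - χ(σ_p))` over the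
plaquettes with all four edges in `Λ`, `μ_Λ` = product counting (= normalised Haar) measure
(Cao (1.1)–(1.2)). This is EXACTLY the free-boundary measure
`Literature.MathematicalPhysics.QuantumFieldTheory.zdWilsonMeasure ρ β Λ` of `Sweep1.lean`
(`zdWilsonAction ρ Λ U = ∑_{p ∈ plaquettesIn Λ} (N - Re tr ρ(U_p))`, product Haar on ALL edges of
`ℤ⁴`, tilted by `exp(-β S_Λ)`: the edges outside `Λ` are independent uniform variables that no
observable supported in `Λ` sees; Cao instead freezes them to `1` — the same marginal on `E(Λ)`).
The Wilson loop variable of a closed lattice loop `γ = e₁ ⋯ e_n` is the (complex, un-normalised)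
character of the ordered holonomy, `W_γ(σ) = χ(σ_{e₁} ⋯ σ_{e_n})` (Cao (1.3)) =
`wilsonLoopVar ρ w U = tr ρ (walkHolonomy U w)` for a closed walk `w` of the nearest-neighbour
graph `zdGraph 4` (`Literature.MathematicalPhysics.QuantumLattice.walkHolonomy`). "Self avoiding
loop" in Cao (§1.2: "no edge is repeated (ignoring orientation)") is Mathlib's
`SimpleGraph.Walk.IsTrail` for a closed walk; the tree's Chatterjee transcriptions
(`chatterjee_z2_wilsonLoops`) use the narrower `IsCycle` (specialise with
`SimpleGraph.Walk.IsCycle.isCircuit` and `IsCircuit.isTrail`). `⟨W_γ⟩_β` "under some subsequential limit of the finite volume lattice gauge theories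
`μ_{Λ,β}` as `Λ ↑ ℤ⁴`" (Remark 1.2.2: the bound holds for ANY such limit) is rendered with
`Sweep1`'s `IsInfiniteVolumeLimit ρ β μ` (weak subsequential limits of the free-boundary measures
along the centred cubes `box 4 L`), a sub-family of Cao's limits — so `FirstOrderWilsonLoop` is
implied by, never stronger than, the printed theorem.

## Contents (source item → declaration → status)

| Cao 2020 (arXiv v3) | declaration | status |
|---|---|---|
| `Δ_G = min_{g ≠ 1} Re(χ(1) - χ(g))`, §1.2 | `actionGap ρ` | def |
| `φ_β(g)`, (1.4) | `phi ρ β g` | def |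
| `r_β = ∑_{g ≠ 1} φ_β(g)⁶`, (1.5) | `rBeta ρ β` | def |
| `A_β = r_β⁻¹ ∑_{g ≠ 1} ρ(g) φ_β(g)⁶`, (1.6) | `aMatrix ρ β` | def |
| `G₀`, `A = |G₀|⁻¹ ∑_{g ∈ G₀} ρ(g)`, §1.2 | `minimizers ρ`, `aLimit ρ` | def |
| `‖·‖_op` | `opNorm` (`Matrix.toEuclideanCLM`) | def |
| threshold (1.7), `c_β` (1.8), r.h.s. of (1.9) | `betaThreshold ρ`, `cBeta ρ β`, `errorBound ρ β` | def |
| `∑_{i=1}^d e^{-ℓ r_β (1 - λ_i(β))}` | `mainTerm ρ β ℓ` (sum over the roots of `charpoly A_β`) | def |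
| `W_γ`, (1.3) | `wilsonLoopVar ρ w` | def |
| cubes `[a₁,b₁] × ⋯ ∩ ℤ⁴`, §1.2/§2.1 | `cube a n` | def |
| **Thm. 1.2.1** (main result) | `FirstOrderWilsonLoop ρ` | named fact |
| proof of Thm. 1.2.1, §4.2 (finite-volume form) | `FirstOrderWilsonLoopFiniteVolume ρ` | named fact |
| **Thm. 3.1.1** (abelian, one-dimensional `ρ`, explicit finite volume) | `AbelianFirstOrderWilsonLoop ρ` | named fact |
| **Lemma A.1** | `ExistsFaithfulUnitaryRepOpNormLtOne G` | named fact — PROVED v1.2 (`…_holds`) |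
| **Lemma A.2** | `OpNormALimitLtOneOfIrreducible ρ` | named fact — PROVED v1.2 (`…_holds`) |

NOT typed: the intermediate results of §3–§4 (vortex/knot decompositions, the Poisson
approximation Props. 3.3.8/4.2.12 and left-tail bounds, which need the paper's internal random
variables `N_γ`), the imported tools (Dobrushin/BFP cluster expansion Thm. 3.4.11 = [BFP2010,
Thm. 2.1]; Chen–Röllin Thm. 3.4.14), and the discrete exterior calculus of §2 (the tree has its
own: `CubicalCochains*`, `AbelianTorusCochains`). Author-stated open directions — extension to
continuous gauge groups (§1.2, "It remains to be seen whether the methods of this paper may be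
extended to continuous groups"), several loops for non-abelian `G` (§1.2), other dimensions
(Remark 1.2.4), a sharper threshold (Remark 1.2.2) — are prose, not statements, and are not typed.

## Faithfulness flags

* `Δ_G`, `log`: Cao's `Δ_G` is UN-normalised (`Re(χ(1) - χ(g)) = N - Re tr ρ(g)`), i.e. `N` times
  the normalised gap `Literature.Barriers.QuantumFields.actionGap` of the barrier catalogue (not
  imported here); `log` is the natural logarithm. `actionGap` is an `sInf` with junk value `0` for
  the trivial group; the facts assume `0 < actionGap ρ`, which is the printed "Suppose `ρ` is
  faithful, so that `Δ_G > 0`" ("the condition `Δ_G > 0` is equivalent to the condition that `ρ` is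
  faithful", §1.2 — for unitary `ρ`).
* `c_β` (1.8) contains `log ‖A_β‖_op⁻¹`; for `A_β = 0` Lean's `Real.log 0⁻¹ = 0` gives `c_β = 0`
  and the trivial bound `(2e+2)d`, WEAKER than the printed `c_β = 0.15` in that corner case.
* The main term is printed as `∑_{i=1}^d e^{-ℓ r_β(1 - λ_i(β))}` over the eigenvalues of the
  Hermitian matrix `A_β`; `mainTerm` sums over the roots (with multiplicity) of the characteristic
  polynomial of `A_β` in `ℂ`, which are those eigenvalues, and is stated in `ℂ` (it is real for
  unitary `ρ`; the proof of Thm. 1.2.1 writes it as `e^{-ℓ r_β} Tr e^{ℓ r_β A_β}`).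
* Thm. 3.1.1 is stated for `G` written multiplicatively (`CommGroup`), `ρ` of degree `N = 1`, with
  `A_β ∈ [-1,1]` read as the real part of the `(0,0)` entry of `aMatrix ρ β` (§3.1: "`A_β ∈ [-1, 1]`
  for all `β ≥ 0`"), and with "the `ℓ^∞` distance between the boundary of `Λ` and the boundary of
  `B_γ`" being `L` replaced by "at least `L`" (the printed bound is decreasing in `L`, so this is
  implied by the printed statement).
* Lemma A.2's "irreducible" is spelled out as: no `ρ(G)`-invariant `ℂ`-subspace of `ℂ^N` other
  than `⊥`, `⊤`.

## References

* S. Cao, CMP 380 (2020) 1439–1505, arXiv:2001.05627v3: §1.2 (model, (1.1)–(1.9), Thm. 1.2.1,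
  Remarks 1.2.2–1.2.5), §3.1 (Thm. 3.1.1), §4.2 (Cor. 4.2.11, Props. 4.2.12–4.2.13, Cor. 4.2.14,
  proof of Thm. 1.2.1), Appendix A (Lemmas A.1, A.2). [Cao2020]
* S. Chatterjee, *Wilson loops in Ising lattice gauge theory*, CMP 377 (2020) 307–340,
  arXiv:1811.09770, Thm. 1.1 (the `ℤ₂` case; tree: `chatterjee_z2_wilsonLoops`,
  `chatterjee_isingGauge_wilsonLoop`). [arXiv181109770]
-/

noncomputable section

open MeasureTheory Filter SimpleGraph
open Literature.Probability.LatticeModels (zdGraph)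
open Literature.MathematicalPhysics.QuantumLattice (walkHolonomy)

namespace Literature.MathematicalPhysics.QuantumFieldTheory.Cao2020

/-! ### The printed quantities `Δ_G`, `φ_β`, `r_β`, `A_β`, `G₀`, `A`, `c_β` (Cao §1.2) -/

section Quantities

variable {G : Type*} [Group G] {N : ℕ} (ρ : G →* Matrix (Fin N) (Fin N) ℂ)

/-- Cao's action gap `Δ_G := min_{g ≠ 1} Re (χ(1) - χ(g))`, `χ = tr ρ`, `χ(1) = N` — the
UN-normalised gap (`N` times the normalised one of the barrier catalogue). "Note the condition
`Δ_G > 0` is equivalent to the condition that `ρ` is faithful." Junk value `sInf ∅ = 0` for the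
trivial group. [cite: Cao2020, §1.2 (display before (1.4))] -/
def actionGap : ℝ :=
  sInf ((fun g : G => (N : ℝ) - (ρ g).trace.re) '' {g | g ≠ 1})

/-- `φ_β(g) := exp(-β Re (χ(1) - χ(g)))`. [cite: Cao2020, §1.2 (1.4)] -/
def phi (β : ℝ) (g : G) : ℝ :=
  Real.exp (-(β * ((N : ℝ) - (ρ g).trace.re)))

/-- Unfolding of `actionGap`. [cite: Cao2020, §1.2] -/
theorem actionGap_def :
    actionGap ρ = sInf ((fun g : G => (N : ℝ) - (ρ g).trace.re) '' {g | g ≠ 1}) := rfl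

variable [Fintype G] [DecidableEq G]

/-- `r_β := ∑_{g ≠ 1} φ_β(g)⁶` (the weight of a minimal vortex: six excited plaquettes).
[cite: Cao2020, §1.2 (1.5)] -/
def rBeta (β : ℝ) : ℝ :=
  ∑ g ∈ Finset.univ.erase (1 : G), phi ρ β g ^ 6

/-- `A_β := r_β⁻¹ ∑_{g ≠ 1} ρ(g) φ_β(g)⁶`, a `d × d` matrix, Hermitian with `‖A_β‖_op ≤ 1` when `ρ`
is unitary. Junk value `0⁻¹ = 0` for the trivial group. [cite: Cao2020, §1.2 (1.6)] -/
def aMatrix (β : ℝ) : Matrix (Fin N) (Fin N) ℂ :=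
  ((rBeta ρ β : ℝ) : ℂ)⁻¹ • ∑ g ∈ Finset.univ.erase (1 : G), ((phi ρ β g ^ 6 : ℝ) : ℂ) • ρ g

/-- `G₀ := {g ∈ G : g ≠ 1, Re (χ(1) - χ(g)) = Δ_G}`, the minimisers of the plaquette energy.
[cite: Cao2020, §1.2 (paragraph before Thm. 1.2.1)] -/
def minimizers : Finset G :=
  (Finset.univ.erase (1 : G)).filter fun g => (N : ℝ) - (ρ g).trace.re = actionGap ρ

/-- `A := |G₀|⁻¹ ∑_{g ∈ G₀} ρ(g)`, the entrywise limit of `A_β` as `β → ∞`.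
[cite: Cao2020, §1.2 (paragraph before Thm. 1.2.1)] -/
def aLimit : Matrix (Fin N) (Fin N) ℂ :=
  (((minimizers ρ).card : ℝ) : ℂ)⁻¹ • ∑ g ∈ minimizers ρ, ρ g

/-- The operator norm `‖M‖_op` of a complex `N × N` matrix acting on `ℂ^N` with its Euclidean
norm (Mathlib: the norm of `Matrix.toEuclideanCLM M`). [folklore] -/
def opNorm (M : Matrix (Fin N) (Fin N) ℂ) : ℝ :=
  ‖Matrix.toEuclideanCLM (n := Fin N) (𝕜 := ℂ) M‖

/-- The threshold `(1000 + 14 log |G|) / Δ_G` of Thm. 1.2.1 ("very loose", Remark 1.2.2); `log`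
is the natural logarithm. [cite: Cao2020, Thm. 1.2.1 (1.7)] -/
def betaThreshold : ℝ :=
  (1000 + 14 * Real.log (Fintype.card G)) / actionGap ρ

/-- `c_β := min(0.15, 2⁻¹⁹ log ‖A_β‖_op⁻¹, 1 - ‖A_β‖_op)`. Junk: for `A_β = 0`, `Real.log 0⁻¹ = 0`
makes `c_β = 0` (printed: `0.15`), which only weakens the bound.
[cite: Cao2020, Thm. 1.2.1 (1.8)] -/
def cBeta (β : ℝ) : ℝ :=
  min (min (0.15 : ℝ) ((2 : ℝ)⁻¹ ^ 19 * Real.log (opNorm (aMatrix ρ β))⁻¹))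
    (1 - opNorm (aMatrix ρ β))

/-- The right-hand side `(2e + 2) d e^{-β Δ_G c_β / (3 + 2 c_β)}` of the main bound.
[cite: Cao2020, Thm. 1.2.1 (1.9)] -/
def errorBound (β : ℝ) : ℝ :=
  (2 * Real.exp 1 + 2) * N * Real.exp (-(β * actionGap ρ * cBeta ρ β / (3 + 2 * cBeta ρ β)))

/-- The first-order term `∑_{i=1}^d e^{-ℓ r_β (1 - λ_i(β))}`, `λ_i(β)` the eigenvalues of `A_β`
(with multiplicity) — here the roots in `ℂ` of the characteristic polynomial of `A_β`; real for
unitary `ρ` (`A_β` Hermitian), and `= e^{-ℓ r_β} Tr e^{ℓ r_β A_β}` (proof of Thm. 1.2.1).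
[cite: Cao2020, Thm. 1.2.1 (1.9)] -/
def mainTerm (β : ℝ) (ℓ : ℕ) : ℂ :=
  (((aMatrix ρ β).charpoly.roots.map fun lam : ℂ =>
      Complex.exp (-((ℓ : ℂ) * ((rBeta ρ β : ℝ) : ℂ) * (1 - lam)))).sum)

/-- Unfolding of `rBeta`. [cite: Cao2020, §1.2 (1.5)] -/
theorem rBeta_def (β : ℝ) : rBeta ρ β = ∑ g ∈ Finset.univ.erase (1 : G), phi ρ β g ^ 6 := rfl

end Quantities

/-! ### Cubes of `ℤ^d` and the Wilson loop variable -/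

section Loops

variable {d : ℕ} {G : Type*} [Group G] {N : ℕ} (ρ : G →* Matrix (Fin N) (Fin N) ℂ)

/-- The lattice cube `([a₁, a₁ + n] × ⋯ × [a_d, a_d + n]) ∩ ℤ^d` of side length `n` with lowest
corner `a` (Cao's finite lattices `Λ` and cubes `B`: rectangles with all side lengths `bᵢ - aᵢ`
equal). [cite: Cao2020, §1.2 and §2.1] -/
def cube (a : Literature.Probability.LatticeModels.Site d) (n : ℕ) :
    Finset (Literature.Probability.LatticeModels.Site d) :=
  Fintype.piFinset fun i => Finset.Icc (a i) (a i + n)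

/-- Unfolding of `cube` (membership: `Fintype.mem_piFinset`, `Finset.mem_Icc` give
`x ∈ cube a n ↔ ∀ i, a i ≤ x i ∧ x i ≤ a i + n`). [cite: Cao2020, §2.1] -/
theorem cube_def (a : Literature.Probability.LatticeModels.Site d) (n : ℕ) :
    cube a n = Fintype.piFinset fun i => Finset.Icc (a i) (a i + n) := rfl

/-- The Wilson loop variable `W_γ(σ) := χ(σ_{e₁} ⋯ σ_{e_n})`, `χ = tr ρ`, of a closed lattice loop
`γ = e₁ ⋯ e_n` — the (complex, un-normalised) character of the ORDERED holonomy of the closed walk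
`w`; reversed edges carry inverses. [cite: Cao2020, §1.2 (display before (1.3))] -/
def wilsonLoopVar {x : Literature.Probability.LatticeModels.Site d} (w : (zdGraph d).Walk x x)
    (U : ZdGaugeConfig d G) : ℂ :=
  (ρ (walkHolonomy U w)).trace

/-- Unfolding of `wilsonLoopVar`. [cite: Cao2020, §1.2] -/
theorem wilsonLoopVar_apply {x : Literature.Probability.LatticeModels.Site d} (w : (zdGraph d).Walk x x)
    (U : ZdGaugeConfig d G) :
    wilsonLoopVar ρ w U = (ρ (walkHolonomy U w)).trace := rfl

end Loops

/-! ### The theorems (named facts) -/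

section Facts

variable {G : Type*} [Group G] [Fintype G] [DecidableEq G] [TopologicalSpace G]
  [DiscreteTopology G] [MeasurableSpace G] [BorelSpace G] {N : ℕ}
  (ρ : G →* Matrix (Fin N) (Fin N) ℂ)

/-- **Cao 2020, Theorem 1.2.1 (Wilson loop expectation to first order, finite gauge group,
`ℤ⁴`, weak coupling).** Let `G` be a finite group and `ρ` a unitary representation of `G` of
dimension `d`, faithful, so that `Δ_G > 0`. Suppose `β ≥ Δ_G⁻¹ (1000 + 14 log |G|)` and
`‖A_β‖_op < 1`, and let `c_β := min(0.15, 2⁻¹⁹ log ‖A_β‖_op⁻¹, 1 - ‖A_β‖_op)`. Then for any self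
avoiding loop `γ` in `ℤ⁴` (closed, no edge repeated) of length `ℓ`,
`|⟨W_γ⟩_β - ∑_{i=1}^d e^{-ℓ r_β (1 - λ_i(β))}| ≤ (2e + 2) d e^{-β Δ_G c_β / (3 + 2 c_β)}`, where
`λ_i(β)` are the eigenvalues of `A_β` and `⟨W_γ⟩_β` is the expectation of `W_γ` under ANY
subsequential infinite-volume limit of the measures `μ_{Λ,β}`, `Λ ↑ ℤ⁴` (Remark 1.2.2) — here:
any `μ` with `IsInfiniteVolumeLimit ρ β μ` (weak subsequential limits of the free-boundary measures
on the centred cubes, a sub-family of the printed limits).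
[cite: Cao2020, Thm. 1.2.1 with Remark 1.2.2] -/
def FirstOrderWilsonLoop : Prop :=
  (∀ g, ρ g ∈ Matrix.unitaryGroup (Fin N) ℂ) → 0 < actionGap ρ →
    ∀ β : ℝ, betaThreshold ρ ≤ β → opNorm (aMatrix ρ β) < 1 →
      ∀ μ : Measure (ZdGaugeConfig 4 G), IsInfiniteVolumeLimit ρ β μ →
        ∀ (x : Literature.Probability.LatticeModels.Site 4) (w : (zdGraph 4).Walk x x), w.IsTrail →
          ‖(∫ U, wilsonLoopVar ρ w U ∂μ) - mainTerm ρ β w.length‖ ≤ errorBound ρ β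

/-- **Cao 2020, Theorem 1.2.1 in finite volume (the form established in its proof, §4.2).** "It
suffices to show the bound (1.9) with `⟨W_γ⟩_β` replaced by `⟨W_γ⟩_{Λ,β}`, with all `Λ`
sufficiently large. In particular, we may assume that `Λ` is such that any cube of side length 50
which contains a vertex of `γ` is completely contained in `Λ`" — and for every such cube `Λ` the
proof gives `|⟨W_γ⟩_{Λ,β} - ∑ᵢ e^{-ℓ r_β (1 - λ_i(β))}| ≤ (2e + 2) d e^{-β Δ_G c_β / (3 + 2 c_β)}`
under the hypotheses of Thm. 1.2.1 (from Cor. 4.2.11, Prop. 4.2.12, Cor. 4.2.14). Here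
`⟨·⟩_{Λ,β}` is the free-boundary expectation `zdWilsonMeasure ρ β Λ` on the cube `Λ = cube a n`.
[cite: Cao2020, §4.2, proof of Thm. 1.2.1 (with Cor. 4.2.11, Props. 4.2.12–4.2.13, Cor. 4.2.14)] -/
def FirstOrderWilsonLoopFiniteVolume : Prop :=
  (∀ g, ρ g ∈ Matrix.unitaryGroup (Fin N) ℂ) → 0 < actionGap ρ →
    ∀ β : ℝ, betaThreshold ρ ≤ β → opNorm (aMatrix ρ β) < 1 →
      ∀ (a : Literature.Probability.LatticeModels.Site 4) (n : ℕ) (x : Literature.Probability.LatticeModels.Site 4)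
        (w : (zdGraph 4).Walk x x), w.IsTrail →
        (∀ v ∈ w.support, ∀ b : Literature.Probability.LatticeModels.Site 4,
          v ∈ cube b 50 → cube b 50 ⊆ cube a n) →
          ‖(∫ U, wilsonLoopVar ρ w U ∂(zdWilsonMeasure ρ β (cube a n))) - mainTerm ρ β w.length‖ ≤
            errorBound ρ β

end Facts

/-! ### The Abelian case with explicit finite-volume constants (Cao §3.1, Thm. 3.1.1) -/

section Abelian

variable {G : Type*} [CommGroup G] [Fintype G] [DecidableEq G] [TopologicalSpace G]
  [DiscreteTopology G] [MeasurableSpace G] [BorelSpace G]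
  (ρ : G →* Matrix (Fin 1) (Fin 1) ℂ)

/-- `A_β ∈ [-1, 1]` for a one-dimensional unitary `ρ` (§3.1: "`A_β ∈ [-1, 1]` for all `β ≥ 0`"):
the real part of the single entry of `aMatrix ρ β`. [cite: Cao2020, §3.1] -/
def aScalar (β : ℝ) : ℝ := (aMatrix ρ β 0 0).re

/-- `c_β := min(0.15, 0.5 log |A_β|⁻¹, 1 - A_β)` of Thm. 3.1.1 (junk `Real.log 0⁻¹ = 0` for
`A_β = 0`, which only weakens the bound). [cite: Cao2020, Thm. 3.1.1 (3.2)] -/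
def cBetaAbelian (β : ℝ) : ℝ :=
  min (min (0.15 : ℝ) (0.5 * Real.log (abs (aScalar ρ β))⁻¹)) (1 - aScalar ρ β)

/-- **Cao 2020, Theorem 3.1.1 (Abelian case, explicit finite volume).** Let `G` be a finite
Abelian group and `ρ` a faithful one-dimensional unitary representation (so `Δ_G > 0`). Let `Λ`
be a cube in `ℤ⁴` of side length `N`, `γ` a self avoiding loop of length `ℓ` in `Λ`, `B_γ ⊆ Λ` a
cube of side length `ℓ` containing `γ`, and let the `ℓ^∞` distance between the boundary of `Λ`
and the boundary of `B_γ` be (at least) `L ≥ 50`. Suppose `β ≥ Δ_G⁻¹ (60 + 14 log(|G| - 1))` and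
`|A_β| < 1`, and put `c_β := min(0.15, 0.5 log |A_β|⁻¹, 1 - A_β)`. Then
`|⟨W_γ⟩_{Λ,β} - e^{-ℓ r_β (1 - A_β)}| ≤
  (2e + 2) (e^{-β Δ_G / 2} + N⁴ e^{-β L Δ_G / 2})^{c_β / (1.5 + c_β)}`.
Rendered with `Λ = cube a n` (so Cao's `N` is `n`), `B_γ = cube b ℓ`, the boundary distance
condition as `aᵢ + L ≤ bᵢ` and `bᵢ + ℓ + L ≤ aᵢ + n` for all `i` (distance `≥ L`; the printed bound
decreases in `L`), and `A_β = aScalar ρ β`. [cite: Cao2020, Thm. 3.1.1] -/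
def AbelianFirstOrderWilsonLoop : Prop :=
  (∀ g, ρ g ∈ Matrix.unitaryGroup (Fin 1) ℂ) → 0 < actionGap ρ →
    ∀ β : ℝ, (60 + 14 * Real.log ((Fintype.card G : ℝ) - 1)) / actionGap ρ ≤ β →
      abs (aScalar ρ β) < 1 →
      ∀ (a : Literature.Probability.LatticeModels.Site 4) (n : ℕ) (b : Literature.Probability.LatticeModels.Site 4) (L : ℕ)
        (x : Literature.Probability.LatticeModels.Site 4) (w : (zdGraph 4).Walk x x),
        w.IsTrail → (∀ v ∈ w.support, v ∈ cube b w.length) → 50 ≤ L →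
        (∀ i, a i + L ≤ b i ∧ b i + w.length + L ≤ a i + n) →
          ‖(∫ U, wilsonLoopVar ρ w U ∂(zdWilsonMeasure ρ β (cube a n))) -
              ((Real.exp (-(w.length * rBeta ρ β * (1 - aScalar ρ β))) : ℝ) : ℂ)‖ ≤
            (2 * Real.exp 1 + 2) *
              (Real.exp (-(β * actionGap ρ / 2)) +
                  (n : ℝ) ^ 4 * Real.exp (-(β * L * actionGap ρ / 2))) ^
                (cBetaAbelian ρ β / (1.5 + cBetaAbelian ρ β))

end Abelian

/-! ### The representation-theoretic lemmas of Appendix A -/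

section RepresentationTheory

variable (G : Type*) [Group G] [Fintype G] [DecidableEq G]

/-- **Cao 2020, Lemma A.1.** A finite group of order at least `3` has a faithful unitary
representation `ρ` with `‖A‖_op < 1` (`A = aLimit ρ`; proof in print: the regular representation
restricted to the sum-zero hyperplane, where `A = -(|G|-1)⁻¹ · id`). [cite: Cao2020, Lemma A.1] -/
def ExistsFaithfulUnitaryRepOpNormLtOne : Prop :=
  3 ≤ Fintype.card G →
    ∃ (N : ℕ) (ρ : G →* Matrix (Fin N) (Fin N) ℂ),
      (∀ g, ρ g ∈ Matrix.unitaryGroup (Fin N) ℂ) ∧ Function.Injective ρ ∧ opNorm (aLimit ρ) < 1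

variable {G} {N : ℕ} (ρ : G →* Matrix (Fin N) (Fin N) ℂ)

/-- **Cao 2020, Lemma A.2.** Let `G` be a finite group of order at least `3` and `ρ` a faithful
unitary representation. If `ρ` is irreducible (no `ρ(G)`-invariant `ℂ`-subspace of `ℂ^N` other
than `⊥` and `⊤`), then `‖A‖_op < 1` (Schur: `A = λ · id` with `λ ∈ (-1, 1)`).
[cite: Cao2020, Lemma A.2] -/
def OpNormALimitLtOneOfIrreducible : Prop :=
  3 ≤ Fintype.card G → (∀ g, ρ g ∈ Matrix.unitaryGroup (Fin N) ℂ) → Function.Injective ρ →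
    (∀ V : Submodule ℂ (Fin N → ℂ), (∀ g, ∀ v ∈ V, (ρ g).mulVec v ∈ V) → V = ⊥ ∨ V = ⊤) →
      opNorm (aLimit ρ) < 1

end RepresentationTheory

/-! ### v1.1 (append-only): interoperability with `AdhikariCao2022` — item (1) of the (D) layer — and the tree's loop class

Adhikari–Cao (Ann. Probab. 53 (2025), arXiv:2202.10375; tree file
`Literature/MathematicalPhysics/QuantumFieldTheory/AdhikariCao2022/CorrelationDecay.lean`, typed the
same day) work in EXACTLY Cao's model (§1.2 of both papers is the same text: finite `G`, unitary `ρ`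
with character `χ`, cubes of `ℤ⁴` with free boundary conditions, `S_Λ = ∑_p Re(χ(1) − χ(σ_p))`,
`Δ_G = min_{g ≠ 1} Re(χ(1) − χ(g))`). That file chose a self-contained finite model (`Cube`,
`EdgeConfig Λ`, `gibbsProb`, `deltaG` as an `iInf`); this file chose the tree's measure-theoretic
free-boundary vocabulary (`Sweep1.zdWilsonMeasure`, `IsInfiniteVolumeLimit`, `walkHolonomy`), which
Thm. 1.2.1 (a statement about infinite-volume limits) needs. The scalar data agree on the nose; the
lemmas below record this so that consumers of `ym-cruxidea-19354-8` can quote (1) and (2) with ONE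
`Δ_G`, one unitarity predicate, one character and one notion of cube. -/

section Bridges

variable {G : Type*} [Group G] {N : ℕ} (ρ : G →* Matrix (Fin N) (Fin N) ℂ)

/-- Cao's `Δ_G` (`actionGap`, an `sInf` over the image of `{g ≠ 1}`) IS Adhikari–Cao's `Δ_G`
(`AdhikariCao2022.deltaG`, an `iInf` over the subtype `{g // g ≠ 1}` of `Re(χ(1) − χ(g))`,
`χ(1) = tr 1 = N`). [cite: Cao2020, §1.2 (display before (1.4))] -/
theorem actionGap_eq_deltaG : actionGap ρ = AdhikariCao2022.deltaG ρ := by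
  unfold actionGap AdhikariCao2022.deltaG iInf
  congr 1
  ext x
  simp only [Set.mem_image, Set.mem_setOf_eq, Set.mem_range, Subtype.exists, exists_prop,
    AdhikariCao2022.character, map_one, Matrix.trace_one, Fintype.card_fin, Complex.sub_re,
    Complex.natCast_re]

/-- The unitarity hypothesis of the facts of this file is `AdhikariCao2022.IsUnitaryRep ρ`
(definitionally). [cite: Cao2020, §1.2 ("Let `ρ` be a unitary representation of `G`")] -/
theorem isUnitaryRep_iff :
    AdhikariCao2022.IsUnitaryRep ρ ↔ ∀ g, ρ g ∈ Matrix.unitaryGroup (Fin N) ℂ := Iff.rfl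

/-- `W_γ = χ(σ_{e₁} ⋯ σ_{e_n})` with Adhikari–Cao's `character ρ = tr ∘ ρ` (definitionally).
[cite: Cao2020, §1.2 (display before (1.3))] -/
theorem wilsonLoopVar_eq_character {d : ℕ} {x : Literature.Probability.LatticeModels.Site d}
    (w : (zdGraph d).Walk x x) (U : ZdGaugeConfig d G) :
    wilsonLoopVar ρ w U = AdhikariCao2022.character ρ (walkHolonomy U w) := rfl

/-- The cube `cube a n ⊆ ℤ⁴` of this file is the vertex set of Adhikari–Cao's `Cube ⟨a, n⟩`
(definitionally: both are `Fintype.piFinset fun i => Icc (a i) (a i + n)`). [cite: Cao2020, §2.1] -/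
theorem cube_eq_vertices (a : Literature.Probability.LatticeModels.Site 4) (n : ℕ) :
    cube a n = (⟨a, n⟩ : AdhikariCao2022.Cube).vertices := rfl

end Bridges

section LoopClass

variable {G : Type*} [Group G] [Fintype G] [DecidableEq G] [TopologicalSpace G]
  [DiscreteTopology G] [MeasurableSpace G] [BorelSpace G] {N : ℕ}
  {ρ : G →* Matrix (Fin N) (Fin N) ℂ}

/-- Thm. 1.2.1 specialised to the tree's loop class `SimpleGraph.Walk.IsCycle` (the class used by
`chatterjee_z2_wilsonLoops`): a cycle is in particular a closed trail, Cao's "self avoiding loop".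
[cite: Cao2020, Thm. 1.2.1] -/
theorem FirstOrderWilsonLoop.of_isCycle (h : FirstOrderWilsonLoop ρ)
    (hρ : ∀ g, ρ g ∈ Matrix.unitaryGroup (Fin N) ℂ) (hΔ : 0 < actionGap ρ) {β : ℝ}
    (hβ : betaThreshold ρ ≤ β) (hA : opNorm (aMatrix ρ β) < 1)
    {μ : Measure (ZdGaugeConfig 4 G)} (hμ : IsInfiniteVolumeLimit ρ β μ)
    {x : Literature.Probability.LatticeModels.Site 4} {w : (zdGraph 4).Walk x x} (hw : w.IsCycle) :
    ‖(∫ U, wilsonLoopVar ρ w U ∂μ) - mainTerm ρ β w.length‖ ≤ errorBound ρ β :=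
  h hρ hΔ β hβ hA μ hμ x w hw.isCircuit.isTrail

/-- The finite-volume form specialised to cycles, with the cube written as Adhikari–Cao's
`Λ.vertices`. [cite: Cao2020, §4.2, proof of Thm. 1.2.1] -/
theorem FirstOrderWilsonLoopFiniteVolume.of_isCycle (h : FirstOrderWilsonLoopFiniteVolume ρ)
    (hρ : ∀ g, ρ g ∈ Matrix.unitaryGroup (Fin N) ℂ) (hΔ : 0 < actionGap ρ) {β : ℝ}
    (hβ : betaThreshold ρ ≤ β) (hA : opNorm (aMatrix ρ β) < 1) (Λ : AdhikariCao2022.Cube)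
    {x : Literature.Probability.LatticeModels.Site 4} {w : (zdGraph 4).Walk x x} (hw : w.IsCycle)
    (hΛ : ∀ v ∈ w.support, ∀ b : Literature.Probability.LatticeModels.Site 4,
      v ∈ cube b 50 → cube b 50 ⊆ Λ.vertices) :
    ‖(∫ U, wilsonLoopVar ρ w U ∂(zdWilsonMeasure ρ β Λ.vertices)) - mainTerm ρ β w.length‖ ≤
      errorBound ρ β :=
  h hρ hΔ β hβ hA Λ.lower Λ.side x w hw.isCircuit.isTrail hΛ

end LoopClass

/-! ### v1.2 (append-only, 2026-08-27): Appendix A PROVED — Lemma A.2 (Schur)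

`OpNormALimitLtOneOfIrreducible_holds`, following the printed proof (App. A): `h G₀ h⁻¹ = G₀`, so `A`
intertwines `ρ`; Schur (an eigenspace of `A` is a non-zero `ρ(G)`-invariant subspace, hence everything)
makes `A = λ·1`; taking traces, `λ N = |G₀|⁻¹ Σ_{G₀} tr ρ(g)` is real (`G₀ = G₀⁻¹`, `tr ρ(g⁻¹) = conj tr ρ(g)`)
with real part `N − Δ_G`, so `λ = 1 − Δ_G/N`; and `0 < Δ_G < 2N` (`Re tr U ≤ N` with equality iff `U = 1`,
Horn–Johnson 7.4.1.4, tree `TraceSingularValueInequality`; faithfulness; `|G| ≥ 3` excludes `ρ = −1` off the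
identity) gives `‖A‖_op = |λ| < 1`.  By-products: `actionGap_pos` (`Δ_G > 0` for faithful unitary `ρ`,
`|G| ≥ 2`), `actionGap_le`, `exists_actionGap_eq` (the infimum is attained).  (The class-function identity
`tr ρ(hgh⁻¹) = tr ρ(g)` is the tree's `CompactGroup.trace_conj_eq`; it is re-derived inline in one line rather
than importing `UnitaryTrick`, which imports all of Mathlib.) -/

open scoped InnerProductSpace

section RepresentationTheoryProofs

variable {G : Type*} [Group G] {N : ℕ} (ρ : G →* Matrix (Fin N) (Fin N) ℂ)

/-- For a unitary representation, `ρ(g⁻¹) = ρ(g)ᴴ`. [folklore] -/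
private theorem map_inv_eq_star (hρ : ∀ g, ρ g ∈ Matrix.unitaryGroup (Fin N) ℂ) (g : G) :
    ρ g⁻¹ = star (ρ g) := by
  have h1 : ρ g⁻¹ * ρ g = 1 := by rw [← map_mul, inv_mul_cancel, map_one]
  have h2 : ρ g * star (ρ g) = 1 := Matrix.mem_unitaryGroup_iff.mp (hρ g)
  calc ρ g⁻¹ = ρ g⁻¹ * (ρ g * star (ρ g)) := by rw [h2, Matrix.mul_one]
    _ = star (ρ g) := by rw [← Matrix.mul_assoc, h1, Matrix.one_mul]

/-- `tr ρ(g⁻¹) = conj (tr ρ(g))` for unitary `ρ`. [folklore] -/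
private theorem trace_map_inv (hρ : ∀ g, ρ g ∈ Matrix.unitaryGroup (Fin N) ℂ) (g : G) :
    (ρ g⁻¹).trace = starRingEnd ℂ ((ρ g).trace) := by
  rw [map_inv_eq_star ρ hρ, Matrix.star_eq_conjTranspose, Matrix.trace_conjTranspose]
  rfl

/-- `Re tr U ≤ N` for unitary `U` (tree: Horn–Johnson 7.4.1.4). [cite: HornJohnson2013, Thm 7.4.1.4] -/
theorem re_trace_le_of_mem_unitaryGroup (U : Matrix (Fin N) (Fin N) ℂ) (hU : U ∈ Matrix.unitaryGroup (Fin N) ℂ) :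
    U.trace.re ≤ N := by
  have := Literature.LinearAlgebra.Matrix.re_trace_le_card_of_mem_unitaryGroup hU
  simpa using this

/-- `Re tr U = N ↔ U = 1` for unitary `U` (tree: Horn–Johnson 7.4.1.4). [cite: HornJohnson2013, Thm 7.4.1.4] -/
theorem re_trace_eq_iff_of_mem_unitaryGroup (U : Matrix (Fin N) (Fin N) ℂ)
    (hU : U ∈ Matrix.unitaryGroup (Fin N) ℂ) : U.trace.re = N ↔ U = 1 := by
  have := Literature.LinearAlgebra.Matrix.re_trace_eq_card_iff_of_mem_unitaryGroup hU
  simpa using this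

/-- `−U` is unitary when `U` is. [folklore] -/
private theorem neg_mem_unitaryGroup {U : Matrix (Fin N) (Fin N) ℂ} (hU : U ∈ Matrix.unitaryGroup (Fin N) ℂ) :
    -U ∈ Matrix.unitaryGroup (Fin N) ℂ := by
  rw [Matrix.mem_unitaryGroup_iff] at hU ⊢
  rw [star_neg, neg_mul_neg, hU]

/-- **Schur step**: a matrix commuting with an irreducible family of matrices over `ℂ` is scalar (via an eigenvalue
and the invariance of its eigenspace). [cite: Cao2020, App. A, proof of Lemma A.2 ("we may apply Schur's lemma")] -/
theorem exists_eq_smul_one_of_comm (hN : 0 < N) (A : Matrix (Fin N) (Fin N) ℂ)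
    (hcomm : ∀ g, ρ g * A = A * ρ g)
    (hirr : ∀ V : Submodule ℂ (Fin N → ℂ), (∀ g, ∀ v ∈ V, (ρ g).mulVec v ∈ V) → V = ⊥ ∨ V = ⊤) :
    ∃ c : ℂ, A = c • 1 := by
  haveI : Nontrivial (Fin N → ℂ) := by
    haveI : Nonempty (Fin N) := ⟨⟨0, hN⟩⟩
    infer_instance
  obtain ⟨c, hc⟩ := Module.End.exists_eigenvalue (Matrix.toLin' A)
  refine ⟨c, ?_⟩
  have hE : Module.End.eigenspace (Matrix.toLin' A) c ≠ ⊥ := Module.End.hasEigenvalue_iff.mp hc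
  have hinv : ∀ g, ∀ v ∈ Module.End.eigenspace (Matrix.toLin' A) c,
      (ρ g).mulVec v ∈ Module.End.eigenspace (Matrix.toLin' A) c := by
    intro g v hv
    rw [Module.End.mem_eigenspace_iff, Matrix.toLin'_apply] at hv ⊢
    rw [Matrix.mulVec_mulVec, ← hcomm g, ← Matrix.mulVec_mulVec, hv, Matrix.mulVec_smul]
  have htop : Module.End.eigenspace (Matrix.toLin' A) c = ⊤ := (hirr _ hinv).resolve_left hE
  apply Matrix.toLin'.injective
  apply LinearMap.ext
  intro v
  have hv : v ∈ Module.End.eigenspace (Matrix.toLin' A) c := htop ▸ Submodule.mem_top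
  rw [Module.End.mem_eigenspace_iff] at hv
  rw [hv, map_smul, Matrix.toLin'_one, LinearMap.smul_apply, LinearMap.id_apply]

/-- The operator norm of a scalar matrix `c • 1` on `ℂ^N`, `N ≥ 1`, is `|c|`. [folklore] -/
private theorem opNorm_smul_one (hN : 0 < N) (c : ℂ) : opNorm (c • (1 : Matrix (Fin N) (Fin N) ℂ)) = ‖c‖ := by
  unfold opNorm
  haveI : Nontrivial (EuclideanSpace ℂ (Fin N)) := by
    apply Module.nontrivial_of_finrank_pos (R := ℂ)
    rw [finrank_euclideanSpace_fin]; exact hN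
  rw [map_smul, map_one, norm_smul, norm_one, mul_one]

variable [Fintype G]

/-- The set over which `Δ_G` is an infimum is finite and, for `|G| ≥ 2`, nonempty; hence `Δ_G` is attained at some
`g₀ ≠ 1`. [cite: Cao2020, §1.2] -/
theorem exists_actionGap_eq (hG : 1 < Fintype.card G) :
    ∃ g₀ : G, g₀ ≠ 1 ∧ (N : ℝ) - (ρ g₀).trace.re = actionGap ρ := by
  haveI : Nontrivial G := Fintype.one_lt_card_iff_nontrivial.mp hG
  have hne : ((fun g : G => (N : ℝ) - (ρ g).trace.re) '' {g | g ≠ 1}).Nonempty := by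
    obtain ⟨g, hg⟩ := exists_ne (1 : G)
    exact ⟨_, g, hg, rfl⟩
  obtain ⟨g₀, hg₀, heq⟩ := hne.csInf_mem (Set.toFinite _)
  exact ⟨g₀, hg₀, heq⟩

/-- `Δ_G ≤ N − Re tr ρ(g)` for every `g ≠ 1`. [cite: Cao2020, §1.2] -/
theorem actionGap_le {g : G} (hg : g ≠ 1) : actionGap ρ ≤ (N : ℝ) - (ρ g).trace.re :=
  csInf_le (Set.toFinite _).bddBelow ⟨g, hg, rfl⟩

/-- `0 < Δ_G` for a faithful unitary `ρ` and `|G| ≥ 2`.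
[cite: Cao2020, §1.2 ("the condition `Δ_G > 0` is equivalent to the condition that `ρ` is faithful")] -/
theorem actionGap_pos (hG : 1 < Fintype.card G) (hρ : ∀ g, ρ g ∈ Matrix.unitaryGroup (Fin N) ℂ)
    (hinj : Function.Injective ρ) : 0 < actionGap ρ := by
  obtain ⟨g₀, hg₀, heq⟩ := exists_actionGap_eq ρ hG
  rw [← heq]
  have hle := re_trace_le_of_mem_unitaryGroup (ρ g₀) (hρ g₀)
  have hne : (ρ g₀).trace.re ≠ N := by
    intro h
    have := (re_trace_eq_iff_of_mem_unitaryGroup (ρ g₀) (hρ g₀)).mp h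
    exact hg₀ (hinj (by rw [this, map_one]))
  have := lt_of_le_of_ne hle hne
  linarith

/-- `Δ_G < 2N` for a faithful unitary `ρ` and `|G| ≥ 3` (otherwise two distinct non-identity elements would both
map to `−1`). [cite: Cao2020, App. A, proof of Lemma A.2] -/
theorem actionGap_lt_two_mul (hG : 3 ≤ Fintype.card G) (hρ : ∀ g, ρ g ∈ Matrix.unitaryGroup (Fin N) ℂ)
    (hinj : Function.Injective ρ) : actionGap ρ < 2 * N := by
  by_contra hcon
  rw [not_lt] at hcon
  -- every `g ≠ 1` has `ρ g = -1`
  have hall : ∀ g : G, g ≠ 1 → ρ g = -1 := by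
    intro g hg
    have h1 := actionGap_le ρ hg
    have h2 := re_trace_le_of_mem_unitaryGroup (-ρ g) (neg_mem_unitaryGroup (hρ g))
    rw [Matrix.trace_neg, Complex.neg_re] at h2
    have h3 : (-ρ g).trace.re = N := by
      rw [Matrix.trace_neg, Complex.neg_re]; linarith
    have := (re_trace_eq_iff_of_mem_unitaryGroup (-ρ g) (neg_mem_unitaryGroup (hρ g))).mp h3
    rw [← neg_neg (ρ g), this]
  obtain ⟨a, b, c, hab, hac, hbc⟩ := Fintype.two_lt_card_iff.mp (by omega : 2 < Fintype.card G)
  -- two of `a, b, c` are distinct non-identity elements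
  have key : ∀ x y : G, x ≠ y → x ≠ 1 → y ≠ 1 → False := fun x y hxy hx hy =>
    hxy (hinj (by rw [hall x hx, hall y hy]))
  by_cases ha : a = 1
  · exact key b c hbc (fun hb => hab (ha.trans hb.symm)) (fun hc => hac (ha.trans hc.symm))
  · by_cases hb : b = 1
    · exact key a c hac ha (fun hc => hbc (hb.trans hc.symm))
    · exact key a b hab ha hb

variable [DecidableEq G]

/-- Unfolding of membership in `minimizers`. [cite: Cao2020, §1.2 (paragraph before Thm. 1.2.1)] -/
theorem mem_minimizers_iff (g : G) :
    g ∈ minimizers ρ ↔ g ≠ 1 ∧ (N : ℝ) - (ρ g).trace.re = actionGap ρ := by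
  simp [minimizers, Finset.mem_filter]

/-- `G₀` is invariant under conjugation. [cite: Cao2020, App. A, proof of Lemma A.2] -/
theorem conj_mem_minimizers {g : G} (hg : g ∈ minimizers ρ) (h : G) : h * g * h⁻¹ ∈ minimizers ρ := by
  rw [mem_minimizers_iff] at hg ⊢
  have htr : (ρ (h * g * h⁻¹)).trace = (ρ g).trace := by
    -- the character is a class function (tree: `CompactGroup.trace_conj_eq`)
    rw [map_mul, map_mul, Matrix.trace_mul_cycle, ← map_mul, inv_mul_cancel, map_one, Matrix.one_mul]
  refine ⟨?_, by rw [htr]; exact hg.2⟩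
  intro h1
  apply hg.1
  have : g = h⁻¹ * (h * g * h⁻¹) * h := by group
  rw [this, h1, mul_one, inv_mul_cancel]

/-- `ρ(h) A ρ(h)⁻¹ = A`: `A` is an intertwiner. [cite: Cao2020, App. A, proof of Lemma A.2] -/
theorem conj_aLimit (h : G) : ρ h * aLimit ρ * ρ h⁻¹ = aLimit ρ := by
  unfold aLimit
  rw [Matrix.mul_smul, Matrix.smul_mul, Finset.mul_sum, Finset.sum_mul]
  congr 1
  refine Finset.sum_nbij' (fun g => h * g * h⁻¹) (fun g => h⁻¹ * g * h) (fun g hg => conj_mem_minimizers ρ hg h)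
    (fun g hg => by simpa using conj_mem_minimizers ρ hg h⁻¹) (fun g _ => by group) (fun g _ => by group) ?_
  intro g _
  rw [map_mul, map_mul]

/-- `ρ(h) A = A ρ(h)`. [cite: Cao2020, App. A, proof of Lemma A.2] -/
theorem mul_aLimit_comm (h : G) : ρ h * aLimit ρ = aLimit ρ * ρ h := by
  have hc := conj_aLimit ρ h
  calc ρ h * aLimit ρ = ρ h * aLimit ρ * ρ h⁻¹ * ρ h := by
        rw [Matrix.mul_assoc (ρ h * aLimit ρ), ← map_mul, inv_mul_cancel, map_one, Matrix.mul_one]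
    _ = aLimit ρ * ρ h := by rw [hc]

/-- `G₀` is closed under inverses (unitary `ρ`). [cite: Cao2020, App. A] -/
theorem inv_mem_minimizers (hρ : ∀ g, ρ g ∈ Matrix.unitaryGroup (Fin N) ℂ) {g : G}
    (hg : g ∈ minimizers ρ) : g⁻¹ ∈ minimizers ρ := by
  rw [mem_minimizers_iff] at hg ⊢
  refine ⟨inv_ne_one.mpr hg.1, ?_⟩
  rw [trace_map_inv ρ hρ, Complex.conj_re]
  exact hg.2

/-- The imaginary parts of the character cancel over `G₀`. [cite: Cao2020, App. A] -/
theorem sum_minimizers_trace_im (hρ : ∀ g, ρ g ∈ Matrix.unitaryGroup (Fin N) ℂ) :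
    ∑ g ∈ minimizers ρ, (ρ g).trace.im = 0 := by
  have h : ∑ g ∈ minimizers ρ, (ρ g).trace.im = ∑ g ∈ minimizers ρ, (ρ g⁻¹).trace.im :=
    Finset.sum_nbij' (fun g => g⁻¹) (fun g => g⁻¹) (fun g hg => inv_mem_minimizers ρ hρ hg)
      (fun g hg => inv_mem_minimizers ρ hρ hg) (fun g _ => inv_inv g) (fun g _ => inv_inv g)
      (fun g _ => by rw [inv_inv])
  have h' : ∑ g ∈ minimizers ρ, (ρ g⁻¹).trace.im = -∑ g ∈ minimizers ρ, (ρ g).trace.im := by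
    rw [← Finset.sum_neg_distrib]
    refine Finset.sum_congr rfl fun g _ => ?_
    rw [trace_map_inv ρ hρ, Complex.conj_im]
  linarith

end RepresentationTheoryProofs

/-- **Cao 2020, Lemma A.2 — PROVED.** For a finite group of order `≥ 3` and a faithful unitary irreducible `ρ`,
`‖A‖_op < 1`: `G₀` is a union of conjugacy classes, so `A` intertwines `ρ` and is a scalar `λ` by Schur; taking
traces, `λ = 1 − Δ_G/N ∈ (−1, 1)` because `0 < Δ_G < 2N` (faithfulness, and `|G| ≥ 3` excludes `ρ ≡ −1` off the
identity). [cite: Cao2020, Lemma A.2] -/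
theorem OpNormALimitLtOneOfIrreducible_holds :
    ∀ {G : Type*} [Group G] [Fintype G] [DecidableEq G] {N : ℕ} (ρ : G →* Matrix (Fin N) (Fin N) ℂ),
      OpNormALimitLtOneOfIrreducible ρ := by
  intro G _ _ _ N ρ hG hρ hinj hirr
  -- `N ≥ 1`: a representation of degree `0` is constant, not faithful on `|G| ≥ 3`.
  have hG1 : 1 < Fintype.card G := by omega
  have hN : 0 < N := by
    rcases Nat.eq_zero_or_pos N with h0 | h0
    · exfalso
      subst h0
      haveI : Nontrivial G := Fintype.one_lt_card_iff_nontrivial.mp hG1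
      obtain ⟨g, hg⟩ := exists_ne (1 : G)
      exact hg (hinj (Subsingleton.elim _ _))
    · exact h0
  -- Schur: `A = c • 1`
  obtain ⟨c, hc⟩ := exists_eq_smul_one_of_comm ρ hN (aLimit ρ) (mul_aLimit_comm ρ) hirr
  -- the minimisers: nonempty, each with `Re tr = N − Δ`
  obtain ⟨g₀, hg₀, hg₀eq⟩ := exists_actionGap_eq ρ hG1
  have hg₀mem : g₀ ∈ minimizers ρ := (mem_minimizers_iff ρ g₀).mpr ⟨hg₀, hg₀eq⟩
  have hcard : 0 < ((minimizers ρ).card : ℝ) := by exact_mod_cast Finset.card_pos.mpr ⟨g₀, hg₀mem⟩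
  -- trace identity: `c * N = |G₀|⁻¹ Σ_{G₀} tr ρ g`
  have htrA : (aLimit ρ).trace = (((minimizers ρ).card : ℝ) : ℂ)⁻¹ * ∑ g ∈ minimizers ρ, (ρ g).trace := by
    unfold aLimit; rw [Matrix.trace_smul, Matrix.trace_sum, smul_eq_mul]
  have htrc : (aLimit ρ).trace = c * N := by
    rw [hc, Matrix.trace_smul, Matrix.trace_one, Fintype.card_fin, smul_eq_mul]
  have hsum_re : (∑ g ∈ minimizers ρ, (ρ g).trace).re = (minimizers ρ).card * ((N : ℝ) - actionGap ρ) := by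
    rw [Complex.re_sum]
    have : ∀ g ∈ minimizers ρ, (ρ g).trace.re = (N : ℝ) - actionGap ρ := fun g hg => by
      have := ((mem_minimizers_iff ρ g).mp hg).2; linarith
    rw [Finset.sum_congr rfl this, Finset.sum_const, nsmul_eq_mul]
  have hsum_im : (∑ g ∈ minimizers ρ, (ρ g).trace).im = 0 := by
    rw [Complex.im_sum]; exact sum_minimizers_trace_im ρ hρ
  -- hence `c = 1 − Δ/N`, a real number
  have hcre : c.re * N = (N : ℝ) - actionGap ρ := by
    have h := congrArg Complex.re (htrc.symm.trans htrA)
    rw [Complex.mul_re, Complex.natCast_re, Complex.natCast_im, mul_zero, sub_zero] at h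
    rw [h, ← Complex.ofReal_inv, Complex.re_ofReal_mul, hsum_re]
    field_simp
  have hcim : c.im = 0 := by
    have h := congrArg Complex.im (htrc.symm.trans htrA)
    rw [Complex.mul_im, Complex.natCast_re, Complex.natCast_im, mul_zero, zero_add] at h
    rw [← Complex.ofReal_inv, Complex.im_ofReal_mul, hsum_im, mul_zero] at h
    have hN' : (N : ℝ) ≠ 0 := by exact_mod_cast hN.ne'
    exact (mul_eq_zero.mp h).resolve_right hN'
  -- `|c| < 1`
  have hΔpos := actionGap_pos ρ hG1 hρ hinj
  have hΔlt := actionGap_lt_two_mul ρ hG hρ hinj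
  have hNpos : (0 : ℝ) < N := by exact_mod_cast hN
  have hc_eq : c = (c.re : ℂ) := by
    apply Complex.ext <;> simp [hcim]
  rw [hc, opNorm_smul_one hN, hc_eq, Complex.norm_real, Real.norm_eq_abs, abs_lt]
  constructor
  · nlinarith
  · nlinarith

/-! ### v1.2 (append-only, 2026-08-27): Appendix A PROVED — Lemma A.1 (regular representation on the sum-zero hyperplane)

`ExistsFaithfulUnitaryRepOpNormLtOne_holds`, with the printed witness (App. A): the left regular
representation `(R_g v)(x) = v(g⁻¹x)` on `ℂ^G` restricted to `V = 𝟙^⊥ = {Σ_i x_i = 0}` and written in an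
orthonormal basis of `V` (degree `N = dim V`): unitary (an isometry in an orthonormal basis), faithful
(`R_g(δ_1 − δ_{x₀}) = δ_g − δ_{g x₀}`), and `tr R_g|_V = tr R_g − tr R_g|_{ℂ𝟙} = 0 − 1` for `g ≠ 1` (trace through
the orthogonal projection: `LinearMap.trace_comp_comm'`, `LinearMap.IsProj.trace`, `LinearMap.trace_eq_sum_inner`),
hence `G₀ = G ∖ {1}`, `A = (n−1)⁻¹ Σ_{g≠1} R_g|_V = −(n−1)⁻¹·1` (`Σ_g R_g = 0` on `V`), `‖A‖_op ≤ (n−1)⁻¹ ≤ ½ < 1`. -/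

/-! ### Lemma A.1: the regular representation on the sum-zero hyperplane -/

namespace RegularRep

variable (G : Type*)

/-- The constant vector `𝟙 ∈ ℂ^G`. [folklore] -/
def ones : EuclideanSpace ℂ G := WithLp.toLp 2 fun _ => (1 : ℂ)

/-- `𝟙(x) = 1`. [folklore] -/
@[simp] private theorem ones_apply (x : G) : (ones G).ofLp x = 1 := rfl

variable [Fintype G]

/-- `⟪𝟙, v⟫ = Σ_x v(x)`. [folklore] -/
private theorem inner_ones_left (v : EuclideanSpace ℂ G) : ⟪ones G, v⟫_ℂ = ∑ x, v.ofLp x := by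
  rw [PiLp.inner_apply]
  simp

/-- The sum-zero hyperplane `V = {x ∈ ℂ^G : Σ_i x_i = 0} = 𝟙^⊥`. [cite: Cao2020, App. A, proof of Lemma A.1] -/
def hyp : Submodule ℂ (EuclideanSpace ℂ G) := (ℂ ∙ ones G)ᗮ

/-- `v ∈ V ↔ Σ_x v(x) = 0` («`V := {x ∈ ℂ^n : Σ_{i=1}^n x_i = 0}`»). [cite: Cao2020, App. A, proof of Lemma A.1] -/
theorem mem_hyp_iff (v : EuclideanSpace ℂ G) : v ∈ hyp G ↔ ∑ x, v.ofLp x = 0 := by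
  rw [hyp, Submodule.mem_orthogonal_singleton_iff_inner_right, inner_ones_left]

/-- An orthonormal basis of the hyperplane. [folklore] -/
def basis : OrthonormalBasis (Fin (Module.finrank ℂ (hyp G))) ℂ (hyp G) := stdOrthonormalBasis ℂ (hyp G)

/-- The degree of the representation (the dimension `|G| − 1` of the hyperplane). [cite: Cao2020, App. A] -/
abbrev deg : ℕ := Module.finrank ℂ (hyp G)

/-- The matrix of a linear map of the hyperplane in the orthonormal basis. [folklore] -/
def mat (f : hyp G →ₗ[ℂ] hyp G) : Matrix (Fin (deg G)) (Fin (deg G)) ℂ :=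
  LinearMap.toMatrix (basis G).toBasis (basis G).toBasis f

/-- Matrix entries in an orthonormal basis are inner products. [folklore] -/
private theorem mat_apply (f : hyp G →ₗ[ℂ] hyp G) (i j : Fin (deg G)) :
    mat G f i j = ⟪basis G i, f (basis G j)⟫_ℂ := by
  rw [mat, LinearMap.toMatrix_apply, OrthonormalBasis.coe_toBasis_repr_apply, OrthonormalBasis.repr_apply_apply,
    OrthonormalBasis.coe_toBasis]

variable [Group G]

/-- The left regular representation of `G` on `ℓ²(G) = ℂ^G`: `(R_g v)(x) = v(g⁻¹ x)`, a linear isometry (a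
permutation of the coordinates). [cite: Cao2020, App. A, proof of Lemma A.1] -/
def reg (g : G) : EuclideanSpace ℂ G ≃ₗᵢ[ℂ] EuclideanSpace ℂ G :=
  LinearIsometryEquiv.piLpCongrLeft 2 ℂ ℂ (Equiv.mulLeft g)

/-- `(R_g v)(x) = v(g⁻¹ x)`. [cite: Cao2020, App. A, proof of Lemma A.1] -/
theorem reg_apply (g : G) (v : EuclideanSpace ℂ G) (x : G) : (reg G g v).ofLp x = v.ofLp (g⁻¹ * x) := by
  simp [reg, LinearIsometryEquiv.piLpCongrLeft_apply, Equiv.piCongrLeft'_apply, Equiv.mulLeft_symm]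

/-- `R_1 = id`. [cite: Cao2020, App. A, proof of Lemma A.1] -/
theorem reg_one (v : EuclideanSpace ℂ G) : reg G 1 v = v := by
  ext x; simp [reg_apply]

/-- `R_{gh} = R_g R_h` (it is a representation). [cite: Cao2020, App. A, proof of Lemma A.1] -/
theorem reg_mul (g h : G) (v : EuclideanSpace ℂ G) : reg G (g * h) v = reg G g (reg G h v) := by
  ext x; simp [reg_apply, mul_assoc]

/-- `R_g 𝟙 = 𝟙`. [cite: Cao2020, App. A, proof of Lemma A.1] -/
theorem reg_ones (g : G) : reg G g (ones G) = ones G := by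
  ext x; simp [reg_apply]

/-- `V` is an invariant subspace of the regular representation. [cite: Cao2020, App. A, proof of Lemma A.1] -/
theorem reg_mem_hyp (g : G) {v : EuclideanSpace ℂ G} (hv : v ∈ hyp G) : reg G g v ∈ hyp G := by
  rw [mem_hyp_iff] at hv ⊢
  simp_rw [reg_apply]
  rw [show ∑ x, v.ofLp (g⁻¹ * x) = ∑ x, v.ofLp x from
    Fintype.sum_equiv (Equiv.mulLeft g⁻¹) _ _ (fun x => rfl)]
  exact hv

/-- The restriction `R_g|_V` of the regular representation to the hyperplane. [cite: Cao2020, App. A, proof of Lemma A.1] -/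
def regH (g : G) : hyp G →ₗ[ℂ] hyp G :=
  (reg G g).toLinearEquiv.toLinearMap.restrict fun _ hv => reg_mem_hyp G g hv

/-- `R_g|_V` agrees with `R_g`. [folklore] -/
@[simp] private theorem coe_regH (g : G) (v : hyp G) : ((regH G g v : hyp G) : EuclideanSpace ℂ G) = reg G g v := rfl

/-- `R_1|_V = id`. [cite: Cao2020, App. A, proof of Lemma A.1] -/
theorem regH_one : regH G 1 = LinearMap.id := by
  ext v; simp [reg_one]

/-- `R_{gh}|_V = R_g|_V R_h|_V`. [cite: Cao2020, App. A, proof of Lemma A.1] -/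
theorem regH_mul (g h : G) : regH G (g * h) = regH G g ∘ₗ regH G h := by
  apply LinearMap.ext; intro v; apply Subtype.ext
  simp [reg_mul]

/-- `R_g|_V` preserves inner products. [cite: Cao2020, App. A, proof of Lemma A.1] -/
theorem inner_regH (g : G) (v w : hyp G) : ⟪regH G g v, regH G g w⟫_ℂ = ⟪v, w⟫_ℂ := by
  rw [Submodule.coe_inner, coe_regH, coe_regH, LinearIsometryEquiv.inner_map_map, ← Submodule.coe_inner]

/-- **The representation of Lemma A.1**: `g ↦` the matrix of `R_g|_V` in an orthonormal basis of the sum-zero hyperplane.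
[cite: Cao2020, App. A, proof of Lemma A.1] -/
def rep : G →* Matrix (Fin (deg G)) (Fin (deg G)) ℂ where
  toFun g := mat G (regH G g)
  map_one' := by simp only [mat, regH_one, LinearMap.toMatrix_id]
  map_mul' g h := by
    simp only [mat, regH_mul, LinearMap.toMatrix_comp (basis G).toBasis (basis G).toBasis (basis G).toBasis]

/-- Unfolding of `rep`. [folklore] -/
private theorem rep_apply (g : G) : rep G g = mat G (regH G g) := rfl

/-- The matrices are unitary (the basis is orthonormal and `R_g` preserves inner products). [cite: Cao2020, App. A] -/
theorem rep_mem_unitaryGroup (g : G) : rep G g ∈ Matrix.unitaryGroup (Fin (deg G)) ℂ := by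
  rw [Matrix.mem_unitaryGroup_iff']
  ext i j
  rw [Matrix.mul_apply, Matrix.one_apply]
  have h : ∀ k, star (rep G g) i k * rep G g k j =
      ⟪regH G g (basis G i), basis G k⟫_ℂ * ⟪basis G k, regH G g (basis G j)⟫_ℂ := by
    intro k
    rw [Matrix.star_apply, rep_apply, mat_apply, mat_apply]
    simp
  simp_rw [h, OrthonormalBasis.sum_inner_mul_inner, inner_regH]
  exact orthonormal_iff_ite.mp (basis G).orthonormal i j

variable [DecidableEq G]

/-- `R_g δ_x = δ_{g x}` (the regular representation is by permutation matrices). [cite: Cao2020, App. A, proof of Lemma A.1] -/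
theorem reg_single (g x : G) : reg G g (EuclideanSpace.single x (1 : ℂ)) = EuclideanSpace.single (g * x) 1 := by
  ext y
  simp only [reg_apply, PiLp.single_apply]
  by_cases h : y = g * x
  · subst h; simp
  · rw [if_neg h, if_neg]
    intro h'; apply h; rw [← h', mul_inv_cancel_left]

omit [Group G] in
/-- A difference of two point masses lies in the hyperplane. [folklore] -/
private theorem single_sub_single_mem_hyp (x y : G) :
    EuclideanSpace.single x (1 : ℂ) - EuclideanSpace.single y 1 ∈ hyp G := by
  rw [mem_hyp_iff, WithLp.ofLp_sub]
  simp [Pi.sub_apply, Finset.sum_sub_distrib]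

/-- The representation is faithful (for `|G| ≥ 2`). [cite: Cao2020, App. A, proof of Lemma A.1] -/
theorem rep_injective (hG : 1 < Fintype.card G) : Function.Injective (rep G) := by
  haveI : Nontrivial G := Fintype.one_lt_card_iff_nontrivial.mp hG
  obtain ⟨x₀, hx₀⟩ := exists_ne (1 : G)
  intro g h hgh
  have hH : regH G g = regH G h := (LinearMap.toMatrix (basis G).toBasis (basis G).toBasis).injective hgh
  set v : EuclideanSpace ℂ G := EuclideanSpace.single 1 (1 : ℂ) - EuclideanSpace.single x₀ 1 with hv
  have hvmem : v ∈ hyp G := single_sub_single_mem_hyp G 1 x₀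
  have heq : reg G g v = reg G h v := by
    have := congrArg (fun f => ((f ⟨v, hvmem⟩ : hyp G) : EuclideanSpace ℂ G)) hH
    simpa using this
  have hval := congrArg (fun w : EuclideanSpace ℂ G => w.ofLp g) heq
  simp only [hv, map_sub, reg_single, mul_one, WithLp.ofLp_sub, Pi.sub_apply, PiLp.single_apply] at hval
  by_contra hne
  have h1 : ¬ (g = g * x₀) := by rw [left_eq_mul]; exact hx₀
  rw [if_neg h1, if_neg hne] at hval
  by_cases h2 : g = h * x₀
  · rw [if_pos h2] at hval; norm_num at hval
  · rw [if_neg h2] at hval; norm_num at hval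

/-- `Σ_{g} R_g v = 0` on the hyperplane, hence `Σ_{g ≠ 1} R_g|_V = −id`. [cite: Cao2020, App. A, proof of Lemma A.1] -/
theorem sum_regH_erase_one : ∑ g ∈ Finset.univ.erase (1 : G), regH G g = -LinearMap.id := by
  rw [Finset.sum_erase_eq_sub (Finset.mem_univ _), regH_one, sub_eq_neg_self]
  apply LinearMap.ext; intro v; apply Subtype.ext
  simp only [LinearMap.coe_sum, Finset.sum_apply, Submodule.coe_sum, LinearMap.zero_apply,
    ZeroMemClass.coe_zero]
  ext x
  rw [WithLp.ofLp_sum, Finset.sum_apply]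
  simp_rw [coe_regH, reg_apply]
  have hv := (mem_hyp_iff G (v : EuclideanSpace ℂ G)).mp v.2
  rw [show ∑ g, (v : EuclideanSpace ℂ G).ofLp (g⁻¹ * x) = ∑ y, (v : EuclideanSpace ℂ G).ofLp y from ?_]
  · simpa using hv
  refine Fintype.sum_equiv ((Equiv.inv G).trans (Equiv.mulRight x)) _ _ (fun g => ?_)
  simp

/-- **Trace of `R_g|_V`**: `tr(R_g|_V) = tr(R_g) − tr(R_g|_{ℂ𝟙}) = 0 − 1 = −1` for `g ≠ 1` (no fixed points).
[cite: Cao2020, App. A, proof of Lemma A.1] -/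
theorem trace_rep (g : G) (hg : g ≠ 1) : (rep G g).trace = -1 := by
  have hones : ones G ≠ 0 := by
    intro h
    have := congrArg (fun w : EuclideanSpace ℂ G => w.ofLp 1) h
    simp at this
  set P := (hyp G).orthogonalProjectionOnto with hP
  set ι := (hyp G).subtype with hι
  set R : EuclideanSpace ℂ G →ₗ[ℂ] EuclideanSpace ℂ G := (reg G g).toLinearEquiv.toLinearMap with hR
  -- `R_g|_V = P ∘ R ∘ ι`, so its trace is the trace on `ℂ^G` of `R ∘ ι ∘ P = R ∘ P_V`
  have h1 : regH G g = (P : EuclideanSpace ℂ G →ₗ[ℂ] hyp G) ∘ₗ (R ∘ₗ ι) := by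
    apply LinearMap.ext; intro v
    rw [LinearMap.comp_apply, LinearMap.comp_apply, ContinuousLinearMap.coe_coe]
    have hmem : R (ι v) ∈ hyp G := reg_mem_hyp G g v.2
    rw [show R (ι v) = ((⟨R (ι v), hmem⟩ : hyp G) : EuclideanSpace ℂ G) from rfl,
      Submodule.orthogonalProjectionOnto_mem_subspace_eq_self]
    rfl
  have h2 : (rep G g).trace = LinearMap.trace ℂ (hyp G) (regH G g) := by
    rw [rep_apply, mat, ← LinearMap.trace_eq_matrix_trace]
  have h3 : LinearMap.trace ℂ (hyp G) (regH G g) =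
      LinearMap.trace ℂ (EuclideanSpace ℂ G) ((R ∘ₗ ι) ∘ₗ (P : EuclideanSpace ℂ G →ₗ[ℂ] hyp G)) := by
    rw [h1, LinearMap.trace_comp_comm']
  -- `ι ∘ P = 1 − P_{ℂ𝟙}` and `R ∘ P_{ℂ𝟙} = P_{ℂ𝟙}`
  set Q : EuclideanSpace ℂ G →ₗ[ℂ] EuclideanSpace ℂ G := ((ℂ ∙ ones G).starProjection).toLinearMap with hQ
  have h4 : (R ∘ₗ ι) ∘ₗ (P : EuclideanSpace ℂ G →ₗ[ℂ] hyp G) = R - Q := by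
    apply LinearMap.ext; intro w
    simp only [LinearMap.comp_apply, LinearMap.sub_apply, ContinuousLinearMap.coe_coe, hι, Submodule.subtype_apply]
    rw [hP, ← Submodule.starProjection_apply, hyp, Submodule.starProjection_orthogonal_val, map_sub]
    congr 1
    rw [hQ, ContinuousLinearMap.coe_coe, Submodule.starProjection_singleton, map_smul, hR]
    simp [reg_ones]
  have h5 : LinearMap.trace ℂ _ Q = 1 := by
    have hproj : LinearMap.IsProj (ℂ ∙ ones G) Q :=
      { map_mem := fun w => by rw [hQ, ContinuousLinearMap.coe_coe]; exact Submodule.starProjection_apply_mem _ w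
        map_id := fun w hw => by
          rw [hQ, ContinuousLinearMap.coe_coe]; exact Submodule.starProjection_eq_self_iff.mpr hw }
    rw [hproj.trace, finrank_span_singleton hones, Nat.cast_one]
  have h6 : LinearMap.trace ℂ _ R = 0 := by
    rw [LinearMap.trace_eq_sum_inner R (EuclideanSpace.basisFun G ℂ)]
    refine Finset.sum_eq_zero fun x _ => ?_
    rw [EuclideanSpace.basisFun_apply, hR]
    simp only [LinearEquiv.coe_coe, LinearIsometryEquiv.coe_toLinearEquiv, reg_single,
      EuclideanSpace.inner_single_left, map_one, one_mul, PiLp.single_apply]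
    rw [if_neg]
    intro h
    apply hg
    calc g = g * x * x⁻¹ := by group
      _ = x * x⁻¹ := by rw [← h]
      _ = 1 := by group
  rw [h2, h3, h4, map_sub, h5, h6, zero_sub]

/-- All non-identity elements are minimisers: `N − Re tr ρ(g) = N + 1` for every `g ≠ 1`, so `Δ_G = N + 1`.
[cite: Cao2020, App. A, proof of Lemma A.1] -/
theorem actionGap_rep (hG : 1 < Fintype.card G) : actionGap (rep G) = deg G + 1 := by
  haveI : Nontrivial G := Fintype.one_lt_card_iff_nontrivial.mp hG
  unfold actionGap
  have : (fun g : G => ((deg G : ℕ) : ℝ) - ((rep G) g).trace.re) '' {g | g ≠ 1} = {((deg G : ℕ) : ℝ) + 1} := by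
    ext r
    simp only [Set.mem_image, Set.mem_setOf_eq, Set.mem_singleton_iff]
    constructor
    · rintro ⟨g, hg, rfl⟩
      rw [trace_rep G g hg]; simp
    · intro hr
      obtain ⟨g, hg⟩ := exists_ne (1 : G)
      refine ⟨g, hg, ?_⟩
      rw [trace_rep G g hg, hr]; simp
  rw [this, csInf_singleton]

/-- `G₀ = G ∖ {1}` for the hyperplane representation. [cite: Cao2020, App. A, proof of Lemma A.1] -/
theorem minimizers_rep (hG : 1 < Fintype.card G) : minimizers (rep G) = Finset.univ.erase 1 := by
  ext g
  simp only [minimizers, Finset.mem_filter, Finset.mem_erase, Finset.mem_univ, and_true]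
  constructor
  · exact fun h => h.1
  · intro hg
    refine ⟨hg, ?_⟩
    rw [actionGap_rep G hG, trace_rep G g hg]
    simp

/-- `A = −(|G| − 1)⁻¹ · 1` for the hyperplane representation. [cite: Cao2020, App. A, proof of Lemma A.1] -/
theorem aLimit_rep (hG : 1 < Fintype.card G) :
    aLimit (rep G) = -((((Fintype.card G - 1 : ℕ) : ℝ) : ℂ)⁻¹) • (1 : Matrix _ _ ℂ) := by
  unfold aLimit
  rw [minimizers_rep G hG, Finset.card_erase_of_mem (Finset.mem_univ _), Finset.card_univ]
  have hsum : ∑ g ∈ Finset.univ.erase (1 : G), rep G g = -1 := by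
    simp_rw [rep_apply, mat]
    rw [← map_sum, sum_regH_erase_one, map_neg, LinearMap.toMatrix_id]
  rw [hsum, smul_neg, neg_smul]

end RegularRep

/-- `‖c • 1‖_op ≤ |c|` on `ℂ^N` (any `N`). [folklore] -/
private theorem opNorm_smul_one_le {N : ℕ} (c : ℂ) : opNorm (c • (1 : Matrix (Fin N) (Fin N) ℂ)) ≤ ‖c‖ := by
  unfold opNorm
  rw [map_smul, map_one, norm_smul]
  calc ‖c‖ * ‖(1 : EuclideanSpace ℂ (Fin N) →L[ℂ] EuclideanSpace ℂ (Fin N))‖ ≤ ‖c‖ * 1 :=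
        mul_le_mul_of_nonneg_left ContinuousLinearMap.norm_id_le (norm_nonneg _)
    _ = ‖c‖ := mul_one _

/-- **Cao 2020, Lemma A.1 — PROVED.** A finite group of order `n ≥ 3` has a faithful unitary representation with
`‖A‖_op < 1`: the regular representation restricted to the sum-zero hyperplane `V ⊂ ℂ^G` (in an orthonormal basis of
`V`), for which every `g ≠ 1` has character `−1`, `G₀ = G ∖ {1}`, and `A = −(n−1)⁻¹ · id_V`, `‖A‖_op ≤ (n−1)⁻¹ ≤ ½`.
[cite: Cao2020, Lemma A.1] -/
theorem ExistsFaithfulUnitaryRepOpNormLtOne_holds :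
    ∀ (G : Type*) [Group G] [Fintype G] [DecidableEq G], ExistsFaithfulUnitaryRepOpNormLtOne G := by
  intro G _ _ _ hG
  have hG1 : 1 < Fintype.card G := by omega
  refine ⟨RegularRep.deg G, RegularRep.rep G, RegularRep.rep_mem_unitaryGroup G, RegularRep.rep_injective G hG1, ?_⟩
  rw [RegularRep.aLimit_rep G hG1]
  refine lt_of_le_of_lt (opNorm_smul_one_le _) ?_
  have hc : (2 : ℝ) ≤ ((Fintype.card G - 1 : ℕ) : ℝ) := by
    have : 2 ≤ Fintype.card G - 1 := by omega
    exact_mod_cast this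
  rw [norm_neg, norm_inv, Complex.norm_real, Real.norm_eq_abs, abs_of_nonneg (by linarith)]
  calc (((Fintype.card G - 1 : ℕ) : ℝ))⁻¹ ≤ (2 : ℝ)⁻¹ := by
        apply inv_anti₀ (by norm_num) hc
    _ < 1 := by norm_num

end Literature.MathematicalPhysics.QuantumFieldTheory.Cao2020
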